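import Summits.BirchSwinnertonDyer.BirchSwinnertonDyer.Theorems.EisensteinPrimesMazurMCOnCellBOfNamedFactsV9
import Summits.BirchSwinnertonDyer.BirchSwinnertonDyer.Theorems.EisensteinPrimesMazurMCOnCellBTwistbackDefectSwapZigzag
import Summits.BirchSwinnertonDyer.BirchSwinnertonDyer.Theorems.EisensteinPrimesMazurMCOnCellBTwistbackSubrowPartnerAnyLinePAdicGZ
import Summits.BirchSwinnertonDyer.BirchSwinnertonDyer.Theorems.SchneiderFreeAdditiveX3PoitouTateSelmerDualityHolds
import Summits.BirchSwinnertonDyer.BirchSwinnertonDyer.Theorems.SchneiderFreeAdditiveX3PoitouTateShaDualityHolds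
import Summits.BirchSwinnertonDyer.Rank1Residual.X2.IsogenyClassStability
import Literature.NumberTheory.EllipticCurves.CyclotomicIwasawaMainTheoremIrreducibleBaseChangeProofs
import HarnessLib

/-!
# Crux 3 `MazurMCOnCellB` (stmt-BirchSwinnertonDyer-19033), line `twistback` v10 (LEAD x2-p1 g14): the crux BY NAME is a TREE
# theorem conditional on EXACTLY the v10 cone — `PublishedInputs` + EIGHT PUBLISHED named facts + Keller–Yin Thm. D (PRE) +
# the open stub 6⁵ `stub_upperPartnerOffSubrowNoConnectedClassShaUnit` («(∃-PARTNER) at X2b pairs off the sub-row whose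
# isogeny class is CONNECTED to NO Ш-unit class by a zig-zag of certified two-step edges»)

LEAD seat `bsd-line-x2-p1` g14 (2026-08-28; `--supports` stmt-BirchSwinnertonDyer-19033; twin of p671228 `…OfNamedFactsV9` for
the v10 stub). THEOREMS ONLY: no `def`, no named fact introduced, no `sorry`; every step is a by-name application of a landed
tree theorem: width seat x2-p1-w3 g14's zig-zag door `…TwistbackDefectSwapZigzag.mazurMainConjectureAt_of_cellB_of_connectedClassShaUnit`
(p671590: `BSD_p` backward along an edge by x2-p1-w6 g3's chain door, FORWARD by the defect swap through STEP L = item -27489 ⟸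
Keller–Yin Thm. D + Hsieh + LZZ, Poitou–Tate discharged), p671228 §1 (Ш-unit class, PUBLISHED only), x2-p1-w3 g11's sub-row
theorem p661280, x2-p1-w6 g2's per-pair door p663790.

WHAT. `mazurMCOnCellB_of_namedFacts_of_upperPartnerOffSubrowNoConnectedClassShaUnit` — CRUX 3 BY NAME from EXACTLY the v10 cone:
`PublishedInputs` + {Disegni 2020 Thm. 4(1), Mazur Cor. 4.1, Hsieh 2014, LZZ 2018, Greenberg–Vatsal Thm. (3.11), Disegni 2020 Thm.
2.4, Nakagawa–Horie–Taya, Wuthrich 2014 Prop. 21} + Keller–Yin Thm. D + 6⁵ (VERBATIM the v10 stub, hypothesis `hStub`) — the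
v10 skeleton's per-pair composition on the Theorems side: Ш-unit class ↦ p671228 §1 (PUB); CONNECTED to a Ш-unit class ↦ w3
g14's door; sub-row ↦ p661280 + p663790; else `hStub` + p663790. The v9 twin's hypothesis (forward-REACHABLE) is implied by
this one's negation pattern (`…DefectSwapZigzag.zigzag_of_reflTransGen_twoStepAt`), so this theorem is the stronger record.

HONEST FRAMING: conditional theorem; the named facts enter exactly as labelled (PUBLISHED ×8 + the route's FACT item -19037;
Keller–Yin Thm. D is an UNREFEREED PREPRINT, arXiv:2402.12781v2 Thm. 5.1.3, flag `KYD-gap`); stub 6⁵ is OPEN as registered —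
its excluded population («W's class is connected to a Ш-unit class in the admissible double-twist graph») is EXPECTED to be
every X2b pair (idea-12 ANCHOR-CENSUS-g8; x2-p1-w5 g3's A10 witness 70971a) but is proved for NO infinite family (the supply
«every component contains a Ш-unit class» is open in print); no registered stub is closed by this file; no summit statement,
no Mazur main conjecture and no BSD is proved for any curve unconditionally; 0 cells / labels / tiers move. BSD is not proved
by any of this.

References: [KellerYin2024] Thm. D (PRE); [Wuthrich2014] Thm. 16, Prop. 21; [Disegni2020] Thm. 4, §2.2 Thm. 2.4;
[GreenbergVatsal2000] Thm. (1.3), §3 Thm. (3.11); [LiuZhangZhang2018] Thms. 1.5.1/1.5.3; [Hsieh2014] Thm. 1; [Mazur1978] Cor.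
4.1; [NakagawaHorie1988] Thm. 1; [CastellaEtAl2021] Thm. 5.3.1, (5.5)–(5.7); [MilneADT2006] I Thm. 7.3; [Miller2011LMS] Def. 1.1.
-/


set_option autoImplicit false
-- `Summit.BirchSwinnertonDyer.BirchSwinnertonDyer.…`: the summit and its single sub-problem share a name.
set_option linter.dupNamespace false

noncomputable section

open scoped Classical MatrixGroups ModularForm

open CongruenceSubgroup WeierstrassCurve NumberField IsDedekindDomain Field
  Literature.NumberTheory.GaloisRepresentations
  Literature.NumberTheory.EllipticCurves
  Literature.NumberTheory.EllipticCurves.ModularForms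
  Literature.NumberTheory.QuadraticFields
  Literature.NumberTheory.EllipticCurves.Rank1Residual
  Literature.NumberTheory.EllipticCurves.Rank1Residual.Typed
  Literature.NumberTheory.EllipticCurves.Wuthrich2014
  Literature.NumberTheory.EllipticCurves.SteinWuthrich2013
  Literature.NumberTheory.EllipticCurves.GreenbergVatsal2000
  Literature.NumberTheory.EllipticCurves.Disegni2020
  Summit.BirchSwinnertonDyer.Rank1Residual
  Summit.BirchSwinnertonDyer.BirchSwinnertonDyer.Theses
  Summit.BirchSwinnertonDyer.BirchSwinnertonDyer.Theorems
  Summit.BirchSwinnertonDyer.BirchSwinnertonDyer.Theorems.EisensteinPrimesMazurMCOnCellBTwistbackTwoStepDefs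

namespace Summit.BirchSwinnertonDyer.BirchSwinnertonDyer.Theorems.EisensteinPrimesMazurMCOnCellBOfNamedFactsV10

/-! ## Crux 3 BY NAME from EXACTLY the v10 cone -/

/-- **CRUX 3 `MazurMCOnCellB` BY NAME from `PublishedInputs` + EIGHT PUBLISHED named facts + Keller–Yin Thm. D (PRE) + the
registered v10 open stub 6⁵ `stub_upperPartnerOffSubrowNoConnectedClassShaUnit` (statement VERBATIM as `hStub`).** The v10
skeleton's per-pair composition on the Theorems side: at an X2b pair `(W, p)` — a Ш-unit class ↦ p671228 §1 (PUBLISHED only); a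
CONNECTED Ш-unit class ↦ x2-p1-w3 g14's zig-zag door p671590 (+ Thm. D); otherwise the partner field comes from the sub-row theorem (x2-p1-w3 g11 p661280,
PUBLISHED inputs: Disegni Thm. 4(1), Greenberg–Vatsal (3.11), Disegni Thm. 2.4, Nakagawa–Horie–Taya) or from `hStub`, a
globally minimal model of the twist exists (`exists_isGloballyMinimal_smul_eq_quadraticTwist`), and x2-p1-w6 g2's per-pair
door p663790 `…OnePartnerAt.mazurMainConjectureAt_of_cellB_of_upper_partnerAt` concludes (STEP L = item -27489 ⟸ Thm. D +
Poitou–Tate + Hsieh + LZZ inside). Of the v8–v10 `stub_printedFacts` (8 conjuncts) ALL are consumed. CONDITIONAL on every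
listed named fact and on the OPEN stub; nothing about any curve is proved unconditionally; BSD is not proved.
[claim: KellerYin2024, status: under-review] [cite: KellerYin2024, Thm. D = Thm. 5.1.3] [cite: Disegni2020, Thm. 4 (§3.2) and §2.2 Thm. 2.4]
[cite: GreenbergVatsal2000, §3 Thm. (3.11) (p. 43)] [cite: NakagawaHorie1988, Thm. 1] [cite: Wuthrich2014, Prop. 21 (p. 400)]
[cite: LiuZhangZhang2018, Thms. 1.5.1 and 1.5.3] [cite: Hsieh2014, Thm. 1] [cite: Mazur1978, Cor. 4.1] [cite: Miller2011LMS, Def. 1.1] -/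
theorem mazurMCOnCellB_of_namedFacts_of_upperPartnerOffSubrowNoConnectedClassShaUnit
    (hP : EisensteinPrimes.PublishedInputs) (hW21 : sha_dvd_analyticSha)
    (hDis : padicBSD_rankOne_nonsplitMult) (hMaz : mazur_not_dvd_maninConstant_of_odd)
    (hH : hsieh2014_exists_anticyclotomicPAdicLFunction) (hF : LiuZhangZhang2018.thm151_thm153_modularCurve_heegnerVector)
    (h311 : thm311_hasUnitContent_iff_and_order_eq_of_lineRamifiedEven)
    (hDGZ : Disegni2020.padicGrossZagier_nonsplitMult)
    (hNHT : Literature.NumberTheory.QuadraticFields.nakagawaHorie_taya_exists_imaginary_h3_eq_one)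
    (hD : KellerYin2024.thmD_imcMult_exists_isBDPLFunction_isTorsion_charIdeal_eq_OPEN)
    (hStub : ∀ (W : WeierstrassCurve ℚ) [W.IsElliptic] [W.IsGloballyMinimal] (p : ℕ) [Fact p.Prime],
      X2.CellB W p →
      ¬ (p = 3 ∧ ¬ W.HasSplitMultiplicativeReductionAtPrime 3 ∧
          ∃ (Φ₀ : AddSubgroup (geomTorsion W (3 : ℤ))) (m : ℕ) (_ : NeZero m) (φ : DirichletCharacter (ZMod 3) m)
            (d : ℕ) (_ : NeZero d) (ψ : DirichletCharacter (ZMod 3) d) (S₀ : Finset (HeightOneSpectrum (𝓞 ℚ))),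
            IsRationalLine W 3 Φ₀ ∧ φ.IsPrimitive ∧ ψ.IsPrimitive ∧
            (∀ (σ : absoluteGaloisGroup ℚ), ∀ P ∈ Φ₀,
              σ • P = (φ ((modNCyclotomicCharacter ℚ m σ : (ZMod m)ˣ) : ZMod m)).val • P) ∧
            (∀ (σ : absoluteGaloisGroup ℚ) (P : geomTorsion W (3 : ℤ)),
              σ • P - (ψ ((modNCyclotomicCharacter ℚ d σ : (ZMod d)ˣ) : ZMod d)).val • P ∈ Φ₀) ∧
            (∀ v ∈ S₀, ((3 : ℕ) : 𝓞 ℚ) ∉ v.asIdeal) ∧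
            (∀ v : HeightOneSpectrum (𝓞 ℚ), v ∉ S₀ → ((3 : ℕ) : 𝓞 ℚ) ∉ v.asIdeal → W.HasGoodReductionAt v) ∧
            1 + ∑ v ∈ S₀, delta W 3 v =
              ∑ v ∈ S₀, ((if φ (Rat.HeightOneSpectrum.natGenerator v : ZMod m) =
                    (Rat.HeightOneSpectrum.natGenerator v : ZMod 3)
                  then sFactor 3 (Rat.HeightOneSpectrum.natGenerator v) else 0) +
                (if ψ (Rat.HeightOneSpectrum.natGenerator v : ZMod d) =
                    (Rat.HeightOneSpectrum.natGenerator v : ZMod 3)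
                  then sFactor 3 (Rat.HeightOneSpectrum.natGenerator v) else 0))) →
      ¬ (∃ (W₁ : WeierstrassCurve ℚ) (_ : W₁.IsElliptic) (_ : W₁.IsGloballyMinimal)
          (W'' : WeierstrassCurve ℚ) (_ : W''.IsElliptic) (_ : W''.IsGloballyMinimal)
          (Wc : WeierstrassCurve ℚ) (_ : Wc.IsElliptic) (_ : Wc.IsGloballyMinimal),
          IsIsogenous W W₁ ∧
          Relation.ReflTransGen (fun A B : WeierstrassCurve ℚ ↦ TwoStepAt p A B ∨
            (TwoStepAt p B A ∧ ∃ (_ : B.IsElliptic) (_ : B.IsGloballyMinimal), X2.CellB B p)) W₁ W'' ∧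
          IsIsogenous W'' Wc ∧
          ∃ q : ℚ, shaAn Wc = (q : ℂ) ∧ padicValRat p q = 0) →
      ∃ (K : Type) (_ : Field K) (_ : NumberField K), IsImaginaryQuadratic K ∧
        SatisfiesHeegnerHypothesis (W.conductorNorm ℤ) K ∧ SatisfiesHeegnerHypothesis p K ∧
        Odd (NumberField.discr K) ∧ NumberField.discr K < -4 ∧
        (W.quadraticTwist (NumberField.discr K : ℚ)).analyticRank = 1 ∧
        ∀ (Wd : WeierstrassCurve ℚ) [Wd.IsElliptic] [Wd.IsGloballyMinimal],
          (∃ C : VariableChange ℚ, C • Wd = W.quadraticTwist (NumberField.discr K : ℚ)) →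
          MissingUpperBoundAt Wd p) :
    Summit.BirchSwinnertonDyer.BirchSwinnertonDyer.Theses.EisensteinPrimes.MazurMCOnCellB := by
  have hPT : ∀ (K : Type) [Field K] [NumberField K],
      Literature.NumberTheory.GaloisCohomology.poitouTate_selmerStructure_duality K :=
    fun K _ _ ↦ SchneiderFreeAdditiveX3.PoitouTateReduction.poitouTate_selmerStructure_duality_holds K
  have hPT2 : ∀ (K : Type) [Field K] [NumberField K],
      Literature.NumberTheory.GaloisCohomology.poitouTate_sha_tateDual K :=
    fun K _ _ ↦ SchneiderFreeAdditiveX3.PoitouTateReduction.poitouTate_sha_tateDual_holds K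
  unfold EisensteinPrimes.MazurMCOnCellB
  intro W _ _ p _ hc
  by_cases h0 : ∃ (W' : WeierstrassCurve ℚ) (_ : W'.IsElliptic) (_ : W'.IsGloballyMinimal),
      IsIsogenous W W' ∧ ∃ q : ℚ, shaAn W' = (q : ℂ) ∧ padicValRat p q = 0
  · exact EisensteinPrimesMazurMCOnCellBOfNamedFactsV9.mazurMainConjectureAt_of_namedFacts_of_classShaUnit
      hP hW21 W p hc h0
  by_cases hR : ∃ (W₁ : WeierstrassCurve ℚ) (_ : W₁.IsElliptic) (_ : W₁.IsGloballyMinimal)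
          (W'' : WeierstrassCurve ℚ) (_ : W''.IsElliptic) (_ : W''.IsGloballyMinimal)
          (Wc : WeierstrassCurve ℚ) (_ : Wc.IsElliptic) (_ : Wc.IsGloballyMinimal),
          IsIsogenous W W₁ ∧
          Relation.ReflTransGen (fun A B : WeierstrassCurve ℚ ↦ TwoStepAt p A B ∨
            (TwoStepAt p B A ∧ ∃ (_ : B.IsElliptic) (_ : B.IsGloballyMinimal), X2.CellB B p)) W₁ W'' ∧
          IsIsogenous W'' Wc ∧
          ∃ q : ℚ, shaAn Wc = (q : ℂ) ∧ padicValRat p q = 0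
  · obtain ⟨W₁, _, _, W'', _, _, Wc, _, _, hiso₁, hz, hisoc, hunit⟩ := hR
    exact EisensteinPrimesMazurMCOnCellBTwistbackDefectSwapZigzag.mazurMainConjectureAt_of_cellB_of_connectedClassShaUnit
      hP hW21 hMaz hH hF hD W p hc ⟨W₁, W'', Wc, inferInstance, inferInstance, inferInstance, inferInstance, inferInstance,
        inferInstance, hiso₁, hz, hisoc, hunit⟩
  -- the partner field: sub-row theorem or the stub
  have hK : ∃ (K : Type) (_ : Field K) (_ : NumberField K), IsImaginaryQuadratic K ∧
        SatisfiesHeegnerHypothesis (W.conductorNorm ℤ) K ∧ SatisfiesHeegnerHypothesis p K ∧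
        Odd (NumberField.discr K) ∧ NumberField.discr K < -4 ∧
        (W.quadraticTwist (NumberField.discr K : ℚ)).analyticRank = 1 ∧
        ∀ (Wd : WeierstrassCurve ℚ) [Wd.IsElliptic] [Wd.IsGloballyMinimal],
          (∃ C : VariableChange ℚ, C • Wd = W.quadraticTwist (NumberField.discr K : ℚ)) →
          MissingUpperBoundAt Wd p := by
    by_cases hsub : p = 3 ∧ ¬ W.HasSplitMultiplicativeReductionAtPrime 3 ∧
          ∃ (Φ₀ : AddSubgroup (geomTorsion W (3 : ℤ))) (m : ℕ) (_ : NeZero m) (φ : DirichletCharacter (ZMod 3) m)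
            (d : ℕ) (_ : NeZero d) (ψ : DirichletCharacter (ZMod 3) d) (S₀ : Finset (HeightOneSpectrum (𝓞 ℚ))),
            IsRationalLine W 3 Φ₀ ∧ φ.IsPrimitive ∧ ψ.IsPrimitive ∧
            (∀ (σ : absoluteGaloisGroup ℚ), ∀ P ∈ Φ₀,
              σ • P = (φ ((modNCyclotomicCharacter ℚ m σ : (ZMod m)ˣ) : ZMod m)).val • P) ∧
            (∀ (σ : absoluteGaloisGroup ℚ) (P : geomTorsion W (3 : ℤ)),
              σ • P - (ψ ((modNCyclotomicCharacter ℚ d σ : (ZMod d)ˣ) : ZMod d)).val • P ∈ Φ₀) ∧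
            (∀ v ∈ S₀, ((3 : ℕ) : 𝓞 ℚ) ∉ v.asIdeal) ∧
            (∀ v : HeightOneSpectrum (𝓞 ℚ), v ∉ S₀ → ((3 : ℕ) : 𝓞 ℚ) ∉ v.asIdeal → W.HasGoodReductionAt v) ∧
            1 + ∑ v ∈ S₀, delta W 3 v =
              ∑ v ∈ S₀, ((if φ (Rat.HeightOneSpectrum.natGenerator v : ZMod m) =
                    (Rat.HeightOneSpectrum.natGenerator v : ZMod 3)
                  then sFactor 3 (Rat.HeightOneSpectrum.natGenerator v) else 0) +
                (if ψ (Rat.HeightOneSpectrum.natGenerator v : ZMod d) =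
                    (Rat.HeightOneSpectrum.natGenerator v : ZMod 3)
                  then sFactor 3 (Rat.HeightOneSpectrum.natGenerator v) else 0))
    · obtain ⟨hp3, hns, hbal⟩ := hsub
      subst hp3
      exact EisensteinPrimesMazurMCOnCellBTwistbackSubrowPartnerAnyLinePAdicGZ.upperPartner_at_three_of_balanceOne_of_padicGZ
        hP hDis h311 hDGZ hNHT W hc hns hbal
    · exact hStub W p hc hsub hR
  obtain ⟨K, _, _, hK, hHN, hHp, hodd, hlt, hr1, hU⟩ := hK
  have hd0 : (NumberField.discr K : ℚ) ≠ 0 := by exact_mod_cast NumberField.discr_ne_zero K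
  obtain ⟨Wd, _, _, C, hC⟩ := exists_isGloballyMinimal_smul_eq_quadraticTwist W hd0
  exact EisensteinPrimesMazurMCOnCellBTwistbackOnePartnerAt.mazurMainConjectureAt_of_cellB_of_upper_partnerAt
    hP hPT hPT2 hH hF hMaz hD W p hc K hK hHN hHp hodd hlt hr1 Wd ⟨C, hC⟩ (hU Wd ⟨C, hC⟩)

end Summit.BirchSwinnertonDyer.BirchSwinnertonDyer.Theorems.EisensteinPrimesMazurMCOnCellBOfNamedFactsV10

end
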